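import Summits.QuantumFields.BalabanUV.T4Continuum.Support.T4TrajectoryDensityDressedLoop

/-!
# `T4Continuum.T4TrajectoryDensityFreshSlices` — part 2 §6 ITERATED along one carried term's life: the birth slice of a carried
# observable-attached term survives every dressed step with radius shrinking by a chosen margin and size multiplied by the step
# cost `e^{3 s_n}` — the FUNCTION-LEVEL source of the scalar size law `A_{n+1} ≤ e^{3(s⁰_n+s₁_n)}·A_n` consumed by
# `T4TrajectoryDensityFreshLaw.freshLaw_of_pipeline` (cell `pub-balaban`, sub-cell `t4`, spine estimate NE1′ (node O3b/H2),
# lineage t4-ne1p-p1 = PROVER seat P1 «RG-trajectory comparison», generation 22; tree target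
# `Summits/QuantumFields/BalabanUV/T4Continuum/Support/`; ADDITIVE — imports part 2 `T4TrajectoryDensityDressedLoop` ONLY)

HONEST FRAMING.  Finite four-torus, rung (B)+1 only — NOT infinite volume, NOT a mass gap, NOT the Clay problem, NOT summit
progress.  «continuum YM on T⁴ ⇐ BetaPertH ∧ nine spine estimates (0/9 proved); BetaPertH ⇐ (D1) ∧ (D4) ∧ CAP+tail; G-an2-4
gates asym, D1 and NE2/3/4».  [folklore] kernel (an induction over part 2's one-step lemma `birthSlice_wOp_shift`, which carries
(1.74)/(1.75) of [Balaban1989LargeFieldII] p. 380 BY NAME through the Literature leaf), 0 sorry, 0 citations; the windows,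
weights, radii and budgets are HYPOTHESES — nothing of Bałaban's densities or the cell's D-terms is asserted.

CONTENTS (§15 of the (w2)-split).  `birthSlice_iterate`: on an additive configuration group with a translation-commuting chart,
a term `G j` with a birth slice (window `𝒦 j`, radius `r j`, size `A j ≥ 0`), carried by `G (n+1) U = wOp (ω n) (μ n) (z₀ n) U
(z ↦ G n (U + z))` through steps whose weights have PROJECTIVE weight slices of oscillation `s n ≤ 1` on the next window with the
next radius `r (n+1) < r n` (the margin is the instantiation's choice — free), with the a.e. nesting and measurability of part
2 §6, has at every later step `n ≥ j` a birth slice on `𝒦 n` of radius `r n` and size `A n`, where `A (n+1) = e^{3 s n}·A n`.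
`birthSlice_iterate_dressed`: the same fed by the DRESSED exponent data of part 1 §3 (`RealBaseAt` + `ExponentSliceAt` for the
action exponent, `PertSlice` for the observable-attached part; `s n = s⁰ n + s₁ n`).  `size_iterate_le`: the produced sizes obey
`A n ≤ A j·(e³)^{n−j}` under the per-step budget — the `hrec`/`size_le_birth_mul_exp` input of §14 with equality.  So the
scalar size law of the (w2-obs) reduction is exactly part 2 §6 iterated; what remains hypothesis is the per-step weight-slice
data ((w2-act) + the centred `PertSlice` of the live terms, itself supplied by §10 from THESE slices one step earlier —
well-founded in `n`) and the window geometry ((w3)⁺).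
-/

namespace Summit.QuantumFields.BalabanUV.T4Continuum.T4TrajectoryDensityDressed

open MeasureTheory Set Metric Filter
open Literature.MathematicalPhysics.QuantumFieldTheory.Balaban1983to89
open T4BirthChartTransport (BirthSlice)
open T4TrajectoryDensity

noncomputable section

section Iterate

variable {V : Type*} [AddCommGroup V] [MeasurableSpace V] {Dir : Type*} {move : V → Dir → ℂ → V} {N : Dir → ℝ}
variable {F : Type*} [NormedAddCommGroup F] [NormedSpace ℂ F]

/-- **PART 2 §6 ITERATED ALONG ONE TERM'S LIFE.**  Birth slice at `j` (size `A j ≥ 0`), the carrying recursion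
`G (n+1) U = wOp (ω n) (μ n) (z₀ n) U (z ↦ G n (U + z))`, projective weight slices of oscillation `s n ≤ 1` on `𝒦 (n+1)` with
radius `r (n+1) < r n`, a.e. nesting `𝒦 (n+1) + z ⊆ 𝒦 n`, measurability, and the size recursion `A (n+1) = e^{3 s n}·A n` ⟹ a
birth slice on `𝒦 n` of radius `r n` and size `A n` at EVERY `n ≥ j` (`birthSlice_wOp_shift` at each step). [folklore] -/
theorem birthSlice_iterate {G : ℕ → V → F} {ω : ℕ → V → V → ℂ} {μ : ℕ → Measure V} {z₀ : ℕ → V} {𝒦 : ℕ → Set V}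
    {w : ℝ} {r s A : ℕ → ℝ} {j : ℕ}
    (hmove : ∀ (U z : V) (d : Dir) (t : ℂ), move (U + z) d t = move U d t + z)
    (hstep : ∀ n, j ≤ n → ∀ U, G (n + 1) U = wOp (ω n) (μ n) (z₀ n) U (fun z => G n (U + z)))
    (hws : ∀ n, j ≤ n → WeightSliceProj (ω n) (μ n) move N (𝒦 (n + 1)) w (r (n + 1)) (s n))
    (hs : ∀ n, j ≤ n → s n ≤ 1) (hr : ∀ n, j ≤ n → r (n + 1) < r n)
    (hnest : ∀ n, j ≤ n → ∀ᵐ z ∂μ n, ∀ U₀ ∈ 𝒦 (n + 1), U₀ + z ∈ 𝒦 n)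
    (hmeas : ∀ n, j ≤ n → ∀ U, AEStronglyMeasurable (fun z => G n (U + z)) (μ n))
    (hbirth : BirthSlice (G j) move N (𝒦 j) w (r j) (A j)) (hA : 0 ≤ A j)
    (hArec : ∀ n, j ≤ n → A (n + 1) = Real.exp (3 * s n) * A n) :
    ∀ n, j ≤ n → 0 ≤ A n ∧ BirthSlice (G n) move N (𝒦 n) w (r n) (A n) := by
  intro n hn
  obtain ⟨d, rfl⟩ := Nat.exists_eq_add_of_le hn
  induction d with
  | zero => exact ⟨hA, by simpa using hbirth⟩
  | succ d ih =>
    obtain ⟨hAd, hsl⟩ := ih (Nat.le_add_right j d)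
    have hjd : j ≤ j + d := Nat.le_add_right j d
    have key := birthSlice_wOp_shift (z₀ := z₀ (j + d)) hmove (hws (j + d) hjd) (hs (j + d) hjd) hsl (hnest (j + d) hjd)
      (hmeas (j + d) hjd) (hr (j + d) hjd) hAd
    have eG : G (j + d + 1) = fun U => wOp (ω (j + d)) (μ (j + d)) (z₀ (j + d)) U (fun z => G (j + d) (U + z)) :=
      funext (hstep (j + d) hjd)
    refine ⟨?_, ?_⟩
    · rw [← Nat.add_assoc, hArec (j + d) hjd]
      exact mul_nonneg (Real.exp_pos _).le hAd
    · rw [← Nat.add_assoc, eG, hArec (j + d) hjd]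
      exact key

variable {ref : ℕ → V → V} {base : ℕ → V → ℝ} {𝒜 𝒬 : ℕ → V → V → ℂ}

/-- **THE SAME, FED BY THE DRESSED EXPONENT DATA** (part 1 §3 `weightSliceProj_of_dressed` at each step): per step `n ≥ j` a real
regular base and an exponent slice about `ref n` for the ACTION exponent `𝒜 n` (oscillation `s⁰ n`) and a perturbation slice
for the observable-attached part `𝒬 n` (oscillation `s₁ n`; by §9's recentring this may be the CENTRED part), with the per-step
budget `s⁰ n + s₁ n ≤ 1`; weight `base n · e^{−(𝒜 n + 𝒬 n)}`; sizes `A (n+1) = e^{3(s⁰ n + s₁ n)}·A n`. [folklore] -/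
theorem birthSlice_iterate_dressed {G : ℕ → V → F} {μ : ℕ → Measure V} {z₀ : ℕ → V} {𝒦 : ℕ → Set V}
    {w : ℝ} {r s₀ s₁ A : ℕ → ℝ} {j : ℕ}
    (hmove : ∀ (U z : V) (d : Dir) (t : ℂ), move (U + z) d t = move U d t + z)
    (hstep : ∀ n, j ≤ n → ∀ U,
      G (n + 1) U = wOp (expWeight (base n) (𝒜 n + 𝒬 n)) (μ n) (z₀ n) U (fun z => G n (U + z)))
    (hB : ∀ n, j ≤ n → RealBaseAt (ref n) (base n) (𝒜 n) (μ n) (𝒦 (n + 1)))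
    (hE : ∀ n, j ≤ n → ExponentSliceAt (ref n) (𝒜 n) (μ n) move N (𝒦 (n + 1)) w (r (n + 1)) (s₀ n))
    (hP : ∀ n, j ≤ n → PertSlice (𝒬 n) (μ n) move N (𝒦 (n + 1)) w (r (n + 1)) (s₁ n))
    (hs : ∀ n, j ≤ n → s₀ n + s₁ n ≤ 1) (hr : ∀ n, j ≤ n → r (n + 1) < r n)
    (hnest : ∀ n, j ≤ n → ∀ᵐ z ∂μ n, ∀ U₀ ∈ 𝒦 (n + 1), U₀ + z ∈ 𝒦 n)
    (hmeas : ∀ n, j ≤ n → ∀ U, AEStronglyMeasurable (fun z => G n (U + z)) (μ n))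
    (hbirth : BirthSlice (G j) move N (𝒦 j) w (r j) (A j)) (hA : 0 ≤ A j)
    (hArec : ∀ n, j ≤ n → A (n + 1) = Real.exp (3 * (s₀ n + s₁ n)) * A n) :
    ∀ n, j ≤ n → 0 ≤ A n ∧ BirthSlice (G n) move N (𝒦 n) w (r n) (A n) :=
  birthSlice_iterate (s := fun n => s₀ n + s₁ n) hmove hstep
    (fun n hn => weightSliceProj_of_dressed (hB n hn) (hE n hn) (hP n hn)) hs hr hnest hmeas hbirth hA hArec

/-- **THE PRODUCED SIZES OBEY §14's LAW.**  `A (n+1) = e^{3(s⁰ n+s₁ n)}·A n` from birth with the per-step budget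
`s⁰ n + s₁ n ≤ 1` gives `A n ≤ A j·(e³)^{n−j}` — the input `hrec` of `freshLaw_of_pipeline` / `size_le_birth_mul_exp` holds with
EQUALITY, so the scalar size law of the (w2-obs) reduction is exactly part 2 §6 iterated. [folklore] -/
theorem size_iterate_le {s₀ s₁ A : ℕ → ℝ} {j : ℕ} (hA : 0 ≤ A j)
    (hArec : ∀ n, j ≤ n → A (n + 1) = Real.exp (3 * (s₀ n + s₁ n)) * A n) (hs : ∀ n, j ≤ n → s₀ n + s₁ n ≤ 1) :
    ∀ n, j ≤ n → 0 ≤ A n ∧ A n ≤ A j * Real.exp 3 ^ (n - j) := by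
  intro n hn
  obtain ⟨d, rfl⟩ := Nat.exists_eq_add_of_le hn
  induction d with
  | zero => exact ⟨hA, by simp⟩
  | succ d ih =>
    obtain ⟨hAd, hle⟩ := ih (Nat.le_add_right j d)
    have hjd : j ≤ j + d := Nat.le_add_right j d
    rw [← Nat.add_assoc, hArec (j + d) hjd]
    refine ⟨mul_nonneg (Real.exp_pos _).le hAd, ?_⟩
    calc Real.exp (3 * (s₀ (j + d) + s₁ (j + d))) * A (j + d) ≤ Real.exp 3 * (A j * Real.exp 3 ^ (j + d - j)) :=
          mul_le_mul (Real.exp_le_exp.mpr (by linarith [hs (j + d) hjd])) hle hAd (Real.exp_pos _).le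
      _ = A j * Real.exp 3 ^ (j + d + 1 - j) := by
          rw [show j + d - j = d by omega, show j + d + 1 - j = d + 1 by omega, pow_succ]
          ring

end Iterate

end

end Summit.QuantumFields.BalabanUV.T4Continuum.T4TrajectoryDensityDressed
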